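import Literature.NumberTheory.EllipticCurves.SexticTwistHeckeCoefficients
import Literature.NumberTheory.EllipticCurves.QuadraticOrderEisensteinNumbers
import HarnessLib

/-!
# `L(E^k ⊗ c, s) = (4^s/2) · Θ-L(Φ_{k,c}, s)`: the twisted `L`-series of `y² = x³ + k` as a weight-one theta `L`-series of `ℤ[ω]`

Topic `Literature/NumberTheory/EllipticCurves`, namespace `Literature.NumberTheory.EllipticCurves.SexticTwist` (sequel to
`SexticTwistHeckeCoefficients`).  Theorems only (no definition, no named fact).  The `j = 0` twin of `QuarticTwistThetaDictionary`
(`L(E_D ⊗ c, s) = ¼ Θ-L(Ψ_{D,c}, s)` over `ℤ[i]`): Ireland–Rosen's Theorem 18.7 «`L(E, s) = L(s, χ)`» for `y² = x³ + D` combined with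
Hecke's theta continuation (Theorem 18.6), in the concrete form of the tree's weight-one theta series of the binary form `y₁² + 3y₂²`
(`LFunctions.BinaryTheta.thetaLFunction`, Hecke 1920 §9) restricted to the order `𝒪₃ = ℤω₃ + ℤ = ℤ[ω]` through `QuadOrder.parityLift`
(`QuadraticOrderEisensteinNumbers`), so that the finite formula `QuadOrder.thetaLFunction_parityLift_one` evaluates it at `s = 1`.

The coefficient.  For `k ∈ ℤ ∖ 0` free of sixth powers and not `16u`, `u ≡ 1 (4)`, `m ≥ 1`, `c : ℤ/m → ℂ`, put on `𝓞 K3 = ℤ[ζ]`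

  `W(x) = 𝟙[x ≡ 1 (3)] · c(N x) · (k/N x) · ν_{4k}((x))`,  `ν_{4k} = EisensteinGrossen.grossenNu (4k) 1 0`

(`(k/·)` the Jacobi symbol, `ν_{4k}(𝔞) = (4k/𝔞)₃` on `(𝔞, 12k) = 1` and `0` otherwise), and on `ℤ² ≅ 𝒪₃` (QuadOrder coordinates
`γ = d₁ + d₂ω₃`, `ω₃ = (1 + √3 i)/2 = ρ + 1`) the function `Φ(d₁, d₂) = W(mkInt d₁ (−d₂))` (so that `γ_d = \overline{e(x_d)}`, `e = embC`).

* §1 `sum_primary_normEq_eq_lFunction` — **`Σ_{x ≡ 1 (3), N x = n} (k/n) ν_{4k}((x)) e(x) = a_n(E^k)`** (the ideal sum of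
  `SexticTwist.lFunction_eq_jacobiSym_mul_sum` read on primary generators: `𝔞 ↦ ϖ_𝔞` is a bijection onto the `x ≡ 1 (3)`);
* §2 `coeff_parityLift` — in BinaryTheta's normalisation: `Σ_{y₁² + 3y₂² = 4n} Φ♯(y)(y₁ − y₂√3 i) = 2 c(n) a_n(E^k)` and the coefficients
  at `m' ≢ 0 (4)` vanish (`y = 2γ`, `\overline{2γ} = y₁ − y₂ √3 i`, `|2γ|² = 4N(γ)`); hence
  `lSeries_coeff_parityLift` — `Σ_{m'} coeff(m') m'^{-s} = 2 · 4^{-s} · Σ_n c(n) a_n n^{-s}` (termwise reindexing, no convergence needed);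
* §3 `weight_periodic` — `W` is periodic modulo `36|k|m` (`ν_{4k}` has modulus `9·4k` by `EisensteinGrossen.psi_span_eq_of_sub_mem` —
  the Artin reciprocity input of `KummerCubicCharacterPeriodicity`; `(k/N x)` has modulus `4|k|` in the odd norm `N x` by quadratic
  reciprocity, `jacobiSym.mod_right`; even norms carry the inadmissible prime `(2)`); `isIntegral_weight` — its values are algebraic integers
  when those of `c` are;
* §4 ★ `lSeries_twist_eq_thetaLFunction` — **`Σ_n c(n) a_n(E^k) n^{-s} = (4^s/2) · BinaryTheta.thetaLFunction 3 (2M) (parityLift Φ) 1 (−√3 i) s`**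
  for `re s > 3/2`, `M = 36|k|m`; whence an entire continuation (`exists_differentiable_twist`).

The prime `5` of `k` (the inert fibre of the BSD programme's `j = 0` supercuspidal cell) is split off from `W` in the sequel
`SexticTwistThetaDictionaryInert`.  Nothing about BSD is proved here.

## References
* K. Ireland, M. Rosen, *A Classical Introduction to Modern Number Theory*, 2nd ed., GTM 84 (1990), Ch. 18 §5 Theorem 6, §7 with §6
  Theorem 7 (PDF pp. 302–306). [IrelandRosen1990]
* E. Hecke, *Eine neue Art von Zetafunktionen …* II, Math. Z. 6 (1920), §9. [Hecke1920]
* N. Koblitz, *Introduction to Elliptic Curves and Modular Forms*, GTM 97 (1993), Ch. II §5. [KoblitzECMF1993]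

## Mathlib / tree search
Tree: `SexticTwist.lFunction_eq_jacobiSym_mul_sum`, `lFunction_apply_prime_pow_eq_zero` (this cluster); `EisensteinGrossen.{grossenNu_apply,
psi_span_eq_of_sub_mem, psi_pow_three, primGen, span_primGen, primGen_sub_one_mem, primGen_eq_of, primGen_span_singleton, isCoprime_three_of_sub_one_mem,
Adm, Adm.coprime_three, embC, embC_mkInt, intBox, abs_le_of_normForm_le, isCoprime_of_sub_mem, ne_zero_of_sub_mem, three}`,
`K3.{mkInt, mkInt_add, mkInt_mul, mkInt_inj, mkInt_intCast, exists_eq_mkInt, absNorm_span_mkInt, intCast_dvd_mkInt_iff}`;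
`BinaryTheta.{coeff, qfEq, mem_qfEq, wt, qf, thetaLFunction, thetaLFunction_eq_LSeries, differentiable_thetaLFunction}`,
`QuadOrder.{parityLift, parityLift_periodic}`.  Mathlib: `Function.Injective.tsum_eq`, `LSeries.term_of_ne_zero`,
`Complex.natCast_mul_natCast_cpow`, `jacobiSym.mod_right`, `IsIntegral.of_pow`, `Finset.sum_bij`, `Finset.sum_nbij'`.
-/

noncomputable section

open scoped Classical ComplexConjugate

open NumberField IsDedekindDomain Finset Complex
open Literature.NumberTheory.NumberFields Literature.NumberTheory.NumberFields.K3
open Literature.NumberTheory.GaloisRepresentations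
open Literature.NumberTheory.LFunctions Literature.NumberTheory.LFunctions.NumberField
open Literature.NumberTheory.LFunctions.EisensteinGrossen Literature.NumberTheory.LFunctions.PlaneLattice

namespace Literature.NumberTheory.EllipticCurves

namespace SexticTwist

variable {k : ℤ} {m : ℕ}

/-! ### §1 Primary elements of given norm, and the coefficient as a sum over them -/

/-- The norm form of `ℤ[ζ]` is non-negative: `4(a² − ab + b²) = (2a − b)² + 3b²`. [cite: IrelandRosen1990, Ch. 9 §1] -/
theorem normForm_nonneg (a b : ℤ) : 0 ≤ a ^ 2 - a * b + b ^ 2 := by nlinarith [sq_nonneg (2 * a - b), sq_nonneg b]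

/-- `N((a + bζ)) = a² − ab + b²` as an integer. [cite: IrelandRosen1990, Ch. 9 §1] -/
theorem absNorm_span_mkInt_cast (a b : ℤ) : ((Ideal.absNorm (Ideal.span {mkInt a b}) : ℕ) : ℤ) = a ^ 2 - a * b + b ^ 2 := by
  rw [absNorm_span_mkInt, Int.natAbs_of_nonneg (normForm_nonneg a b)]

/-- Membership in the coordinate box of the elements of norm `n`: `|a|, |b| ≤ n + 1`. [cite: IrelandRosen1990, Ch. 9 §1] -/
theorem mem_box_of_normForm_eq {a b : ℤ} {n : ℕ} (h : a ^ 2 - a * b + b ^ 2 = n) :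
    (a, b) ∈ (Finset.Icc (-((n + 1 : ℕ) : ℤ)) (n + 1 : ℕ)) ×ˢ (Finset.Icc (-((n + 1 : ℕ) : ℤ)) (n + 1 : ℕ)) := by
  obtain ⟨ha, hb⟩ := abs_le_of_normForm_le (N := n) h.le
  rw [Finset.mem_product, Finset.mem_Icc, Finset.mem_Icc]
  push_cast
  exact ⟨abs_le.mp ha, abs_le.mp hb⟩

/-- The coordinate set `A_n = {(a, b) : a² − ab + b² = n}` and its membership. [cite: IrelandRosen1990, Ch. 9 §1] -/
theorem mem_filter_normForm {n : ℕ} {p : ℤ × ℤ} :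
    p ∈ ((Finset.Icc (-((n + 1 : ℕ) : ℤ)) (n + 1 : ℕ)) ×ˢ (Finset.Icc (-((n + 1 : ℕ) : ℤ)) (n + 1 : ℕ))).filter
        (fun p : ℤ × ℤ ↦ p.1 ^ 2 - p.1 * p.2 + p.2 ^ 2 = n) ↔ p.1 ^ 2 - p.1 * p.2 + p.2 ^ 2 = n := by
  rw [Finset.mem_filter]
  exact ⟨fun h ↦ h.2, fun h ↦ ⟨mem_box_of_normForm_eq h, h⟩⟩

/-- **From ideals to primary elements, norm by norm**: for `F` vanishing on the ideals not prime to `3`,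
`Σ_{N𝔞 = n} F(𝔞) = Σ_{a² − ab + b² = n, a + bζ ≡ 1 (3)} F((a + bζ))` (`𝔞 ↦ ϖ_𝔞` is a bijection from the ideals prime to `3` onto the
elements `≡ 1 (mod 3)`, Ireland–Rosen Prop. 9.3.5). [cite: IrelandRosen1990, Ch. 9 §3 Prop. 9.3.5] -/
theorem sum_idealsOfNorm_eq_sum_primary (F : Ideal (𝓞 K3) → ℂ) (hF : ∀ I, ¬ IsCoprime I three → F I = 0) (n : ℕ) :
    ∑ I ∈ idealsOfNorm K3 n, F I =
      ∑ p ∈ (((Finset.Icc (-((n + 1 : ℕ) : ℤ)) (n + 1 : ℕ)) ×ˢ (Finset.Icc (-((n + 1 : ℕ) : ℤ)) (n + 1 : ℕ))).filter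
          (fun p : ℤ × ℤ ↦ p.1 ^ 2 - p.1 * p.2 + p.2 ^ 2 = n)).filter (fun p : ℤ × ℤ ↦ mkInt p.1 p.2 - 1 ∈ three),
        F (Ideal.span {mkInt p.1 p.2}) := by
  -- drop the ideals not prime to `3`
  rw [← Finset.sum_filter_add_sum_filter_not (idealsOfNorm K3 n) (fun I ↦ IsCoprime I three)]
  have hzero : ∑ I ∈ (idealsOfNorm K3 n).filter (fun I ↦ ¬ IsCoprime I three), F I = 0 :=
    Finset.sum_eq_zero fun I hI ↦ hF I (Finset.mem_filter.mp hI).2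
  rw [hzero, add_zero]
  symm
  refine Finset.sum_bij (fun p _ ↦ Ideal.span {mkInt p.1 p.2}) ?_ ?_ ?_ (fun _ _ ↦ rfl)
  · intro p hp
    rw [Finset.mem_filter] at hp
    obtain ⟨hp, h1⟩ := hp
    rw [mem_filter_normForm] at hp
    rw [Finset.mem_filter, mem_idealsOfNorm]
    refine ⟨?_, isCoprime_three_of_sub_one_mem h1⟩
    zify
    rw [absNorm_span_mkInt_cast, hp]
  · intro p hp q hq hpq
    rw [Finset.mem_filter] at hp hq
    have h := primGen_span_singleton hp.2
    rw [hpq, primGen_span_singleton hq.2, mkInt_inj] at h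
    exact Prod.ext h.1.symm h.2.symm
  · intro I hI
    rw [Finset.mem_filter, mem_idealsOfNorm] at hI
    obtain ⟨hIn, hcop⟩ := hI
    obtain ⟨a, b, hab⟩ := exists_eq_mkInt (primGen I)
    refine ⟨(a, b), ?_, ?_⟩
    · rw [Finset.mem_filter, mem_filter_normForm, ← hab]
      refine ⟨?_, primGen_sub_one_mem hcop⟩
      have h := absNorm_span_mkInt_cast a b
      rw [← hab, span_primGen hcop, hIn] at h
      exact h.symm
    · simp only
      rw [← hab, span_primGen hcop]

/-- The weight `ν_{4k}((x)) e(ϖ_{(x)})`-style functions vanish off the ideals prime to `3` (admissibility contains coprimality to `3`).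
[cite: IrelandRosen1990, Ch. 18 §7 («if `P ∣ 6D` then `χ(P) = 0`»)] -/
theorem grossenNu_eq_zero_of_not_isCoprime_three (D : 𝓞 K3) {I : Ideal (𝓞 K3)} (h : ¬ IsCoprime I three) :
    grossenNu D 1 0 I = 0 := by
  rw [grossenNu_apply, if_neg]
  exact fun hadm ↦ h hadm.coprime_three

/-- **`Σ_{x ≡ 1 (3), N x = n} (k/n) ν_{4k}((x)) e(x) = a_n(E^k)`** (`k ≠ 0` sixth-power-free, not `16u` with `u ≡ 1 (4)`): the ideal sum of
`lFunction_eq_jacobiSym_mul_sum` on primary generators. [cite: IrelandRosen1990, Ch. 18 §7 with §6 Theorem 7 (PDF pp. 304–306)] -/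
theorem sum_primary_normEq_eq_lFunction (hk : k ≠ 0) (h6 : ∀ q : ℕ, q.Prime → ¬ (q : ℤ) ^ 6 ∣ k)
    (h2 : ¬ ∃ u : ℤ, u % 4 = 1 ∧ k = 16 * u) (n : ℕ) :
    ∑ p ∈ (((Finset.Icc (-((n + 1 : ℕ) : ℤ)) (n + 1 : ℕ)) ×ˢ (Finset.Icc (-((n + 1 : ℕ) : ℤ)) (n + 1 : ℕ))).filter
          (fun p : ℤ × ℤ ↦ p.1 ^ 2 - p.1 * p.2 + p.2 ^ 2 = n)).filter (fun p : ℤ × ℤ ↦ mkInt p.1 p.2 - 1 ∈ three),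
        (jacobiSym k n : ℂ) * grossenNu ((4 * k : ℤ) : 𝓞 K3) 1 0 (Ideal.span {mkInt p.1 p.2}) * embC ((mkInt p.1 p.2 : 𝓞 K3) : K3) =
      ((mordellCurve (k : ℚ)).LFunction n : ℂ) := by
  rw [lFunction_eq_jacobiSym_mul_sum hk h6 h2 n, Finset.mul_sum,
    sum_idealsOfNorm_eq_sum_primary _ (fun I hI ↦ by rw [grossenNu_eq_zero_of_not_isCoprime_three _ hI, zero_mul, mul_zero])]
  refine Finset.sum_congr rfl fun p hp ↦ ?_
  rw [Finset.mem_filter] at hp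
  rw [primGen_span_singleton hp.2, mul_assoc]

/-! ### §2 The theta coefficient in `BinaryTheta`'s normalisation (`y = 2γ`, `γ = \overline{e(x)}`) -/

/-- `2 e(a + bζ) = (2a − b) + b√3 i`, i.e. `\overline{2γ} = y₁ − y₂ √3 i` for `y = (2a − b, −b)`, `γ = \overline{e(a + bζ)}`.
[cite: Hecke1920, §9] -/
theorem two_mul_embC_mkInt (a b : ℤ) :
    2 * embC ((mkInt a b : 𝓞 K3) : K3) = ((2 * a - b : ℤ) : ℂ) + ((-b : ℤ) : ℂ) * (-((Real.sqrt 3 : ℂ) * I)) := by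
  rw [embC_mkInt, w]
  apply Complex.ext <;> simp <;> ring

/-- `(2a − b)² + 3b² = 4(a² − ab + b²)`. [cite: Hecke1920, §9] -/
theorem qf_coords (a b : ℤ) : BinaryTheta.qf 3 (2 * a - b, -b) = 4 * (a ^ 2 - a * b + b ^ 2) := by
  simp only [BinaryTheta.qf]; push_cast; ring

/-- **The theta coefficients at `4n`**: for any `W : 𝓞 K3 → ℂ` and `Φ(d) = W(mkInt d₁ (−d₂))`,
`Σ_{y₁² + 3y₂² = 4n} Φ♯(y) (y₁ − y₂√3 i) = 2 Σ_{a² − ab + b² = n} W(a + bζ) e(a + bζ)` (`y = (2a − b, −b)`, `Φ♯ = parityLift Φ` vanishes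
off `y₁ ≡ y₂ (2)`). [cite: Hecke1920, §9] -/
theorem coeff_parityLift (W : 𝓞 K3 → ℂ) (n : ℕ) :
    BinaryTheta.coeff 3 1 (-((Real.sqrt 3 : ℂ) * I)) (QuadOrder.parityLift fun d : ℤ × ℤ ↦ W (mkInt d.1 (-d.2))) (4 * n) =
      2 * ∑ p ∈ ((Finset.Icc (-((n + 1 : ℕ) : ℤ)) (n + 1 : ℕ)) ×ˢ (Finset.Icc (-((n + 1 : ℕ) : ℤ)) (n + 1 : ℕ))).filter
          (fun p : ℤ × ℤ ↦ p.1 ^ 2 - p.1 * p.2 + p.2 ^ 2 = n), W (mkInt p.1 p.2) * embC ((mkInt p.1 p.2 : 𝓞 K3) : K3) := by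
  rw [BinaryTheta.coeff]
  -- restrict to `y₁ ≡ y₂ (2)`
  rw [← Finset.sum_filter_add_sum_filter_not (BinaryTheta.qfEq 3 (4 * n)) (fun y : ℤ × ℤ ↦ (2 : ℤ) ∣ y.1 - y.2)]
  have hzero : ∑ y ∈ (BinaryTheta.qfEq 3 (4 * n)).filter (fun y : ℤ × ℤ ↦ ¬ (2 : ℤ) ∣ y.1 - y.2),
      QuadOrder.parityLift (fun d : ℤ × ℤ ↦ W (mkInt d.1 (-d.2))) y * BinaryTheta.wt 1 (-((Real.sqrt 3 : ℂ) * I)) y = 0 := by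
    refine Finset.sum_eq_zero fun y hy ↦ ?_
    rw [Finset.mem_filter] at hy
    rw [QuadOrder.parityLift, if_neg hy.2, zero_mul]
  rw [hzero, add_zero, Finset.mul_sum]
  symm
  refine Finset.sum_nbij' (fun p : ℤ × ℤ ↦ (2 * p.1 - p.2, -p.2)) (fun y : ℤ × ℤ ↦ ((y.1 - y.2) / 2, -y.2)) ?_ ?_ ?_ ?_ ?_
  · intro p hp
    rw [mem_filter_normForm] at hp
    rw [Finset.mem_filter, BinaryTheta.mem_qfEq, qf_coords, hp]
    exact ⟨by push_cast; ring, ⟨p.1, by ring⟩⟩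
  · intro y hy
    rw [Finset.mem_filter, BinaryTheta.mem_qfEq] at hy
    obtain ⟨hq, t, ht⟩ := hy
    rw [mem_filter_normForm]
    have h1 : (y.1 - y.2) / 2 = t := by rw [ht]; simp
    simp only [h1]
    have hy1 : y.1 = 2 * t + y.2 := by linarith
    have hq' : BinaryTheta.qf 3 y = 4 * n := by exact_mod_cast hq
    simp only [BinaryTheta.qf, hy1] at hq'
    push_cast at hq'
    linarith
  · intro p hp
    ext <;> simp
  · intro y hy
    rw [Finset.mem_filter] at hy
    obtain ⟨-, t, ht⟩ := hy
    have h1 : (y.1 - y.2) / 2 = t := by rw [ht]; simp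
    ext
    · simp [h1]; linarith
    · simp
  · intro p hp
    simp only [QuadOrder.parityLift, BinaryTheta.wt]
    have hpar : (2 : ℤ) ∣ 2 * p.1 - p.2 - -p.2 := ⟨p.1, by ring⟩
    rw [if_pos hpar, show (2 * p.1 - p.2 - -p.2) / 2 = p.1 by
      rw [show 2 * p.1 - p.2 - -p.2 = 2 * p.1 by ring]; simp, neg_neg, mul_left_comm, two_mul_embC_mkInt]
    push_cast
    ring

/-- **The theta coefficients vanish off the multiples of `4`** (`y₁ ≡ y₂ (2)` forces `4 ∣ y₁² + 3y₂²`). [cite: Hecke1920, §9] -/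
theorem coeff_parityLift_eq_zero (W : 𝓞 K3 → ℂ) {m' : ℕ} (hm : ¬ 4 ∣ m') :
    BinaryTheta.coeff 3 1 (-((Real.sqrt 3 : ℂ) * I)) (QuadOrder.parityLift fun d : ℤ × ℤ ↦ W (mkInt d.1 (-d.2))) m' = 0 := by
  rw [BinaryTheta.coeff]
  refine Finset.sum_eq_zero fun y hy ↦ ?_
  rw [BinaryTheta.mem_qfEq] at hy
  rw [QuadOrder.parityLift]
  split_ifs with hpar
  · exfalso
    apply hm
    obtain ⟨t, ht⟩ := hpar
    have hy1 : y.1 = 2 * t + y.2 := by linarith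
    have h4 : (4 : ℤ) ∣ (m' : ℤ) := by
      rw [← hy]; simp only [BinaryTheta.qf, hy1]; exact ⟨t ^ 2 + t * y.2 + y.2 ^ 2, by ring⟩
    exact_mod_cast h4
  · rw [zero_mul]

/-- **The `L`-series of the theta coefficients is `2 · 4^{-s} · Σ_n (Σ_{N x = n} W(x) e(x)) n^{-s}`** (termwise: the coefficients live on
`4ℕ`). [cite: Hecke1920, §9] -/
theorem lSeries_coeff_parityLift (W : 𝓞 K3 → ℂ) (s : ℂ) :
    LSeries (BinaryTheta.coeff 3 1 (-((Real.sqrt 3 : ℂ) * I)) (QuadOrder.parityLift fun d : ℤ × ℤ ↦ W (mkInt d.1 (-d.2)))) s =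
      2 * (4 : ℂ) ^ (-s) * LSeries (fun n : ℕ ↦ ∑ p ∈ ((Finset.Icc (-((n + 1 : ℕ) : ℤ)) (n + 1 : ℕ)) ×ˢ
          (Finset.Icc (-((n + 1 : ℕ) : ℤ)) (n + 1 : ℕ))).filter (fun p : ℤ × ℤ ↦ p.1 ^ 2 - p.1 * p.2 + p.2 ^ 2 = n),
            W (mkInt p.1 p.2) * embC ((mkInt p.1 p.2 : 𝓞 K3) : K3)) s := by
  set f := BinaryTheta.coeff 3 1 (-((Real.sqrt 3 : ℂ) * I)) (QuadOrder.parityLift fun d : ℤ × ℤ ↦ W (mkInt d.1 (-d.2))) with hf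
  set g : ℕ → ℂ := fun n : ℕ ↦ ∑ p ∈ ((Finset.Icc (-((n + 1 : ℕ) : ℤ)) (n + 1 : ℕ)) ×ˢ
      (Finset.Icc (-((n + 1 : ℕ) : ℤ)) (n + 1 : ℕ))).filter (fun p : ℤ × ℤ ↦ p.1 ^ 2 - p.1 * p.2 + p.2 ^ 2 = n),
        W (mkInt p.1 p.2) * embC ((mkInt p.1 p.2 : 𝓞 K3) : K3) with hg
  have hsupp : Function.support (LSeries.term f s) ⊆ Set.range (fun n : ℕ ↦ 4 * n) := by
    intro m' hm'
    rw [Function.mem_support] at hm'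
    by_contra hrange
    apply hm'
    have h4 : ¬ 4 ∣ m' := fun ⟨t, ht⟩ ↦ hrange ⟨t, ht.symm⟩
    rcases eq_or_ne m' 0 with rfl | h0
    · exact LSeries.term_zero _ _
    · rw [LSeries.term_of_ne_zero h0, hf, coeff_parityLift_eq_zero W h4, zero_div]
  rw [LSeries, ← (mul_right_injective₀ (show (4 : ℕ) ≠ 0 by norm_num)).tsum_eq hsupp, LSeries, ← tsum_mul_left]
  refine tsum_congr fun n ↦ ?_
  rcases eq_or_ne n 0 with rfl | hn
  · simp [LSeries.term_zero]
  · have h4n : 4 * n ≠ 0 := by omega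
    have hc : f (4 * n) = 2 * g n := coeff_parityLift W n
    rw [LSeries.term_of_ne_zero h4n, LSeries.term_of_ne_zero hn, hc, Nat.cast_mul,
      Complex.natCast_mul_natCast_cpow, Complex.cpow_neg]
    have h4s : ((4 : ℕ) : ℂ) ^ s ≠ 0 := by
      rw [Ne, cpow_eq_zero_iff, not_and_or]; exact Or.inl (by norm_num)
    have hns : (n : ℂ) ^ s ≠ 0 := by
      rw [Ne, cpow_eq_zero_iff, not_and_or]; exact Or.inl (by exact_mod_cast hn)
    field_simp
    ring

/-! ### §3 The weight `W_{k,c}`: periodicity modulo `36|k|m` and integrality -/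

section Weight

variable (k) (m) (c : ZMod m → ℂ)

/-- The norm form along a congruence: `N(x + My) = N(x) + M·t`. [cite: IrelandRosen1990, Ch. 9 §1] -/
theorem normForm_add_mul (a b a' b' M : ℤ) :
    (a + M * a') ^ 2 - (a + M * a') * (b + M * b') + (b + M * b') ^ 2 =
      (a ^ 2 - a * b + b ^ 2) + M * (2 * a * a' + M * a' ^ 2 - a * b' - a' * b - M * a' * b' + 2 * b * b' + M * b' ^ 2) := by
  ring

/-- An element `x ≡ 1`-type fact: if `N(a + bζ)` is even then `2 ∣ a + bζ` (`a² − ab + b²` is odd unless `a, b` are both even).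
[cite: IrelandRosen1990, Ch. 9 §1 Prop. 9.1.4 (the prime `2` is inert)] -/
theorem two_dvd_of_even_normForm {a b : ℤ} (h : (2 : ℤ) ∣ a ^ 2 - a * b + b ^ 2) : (2 : 𝓞 K3) ∣ mkInt a b := by
  have key : ∀ u v : ZMod 2, u ^ 2 - u * v + v ^ 2 = 0 → u = 0 ∧ v = 0 := by decide
  have h' : ((a : ZMod 2)) ^ 2 - (a : ZMod 2) * (b : ZMod 2) + (b : ZMod 2) ^ 2 = 0 := by
    have := (ZMod.intCast_zmod_eq_zero_iff_dvd _ 2).mpr h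
    push_cast at this
    exact this
  obtain ⟨hu, hv⟩ := key _ _ h'
  have h2 : ((2 : ℤ) : 𝓞 K3) ∣ mkInt a b := by
    rw [intCast_dvd_mkInt_iff]
    exact ⟨(ZMod.intCast_zmod_eq_zero_iff_dvd a 2).mp hu, (ZMod.intCast_zmod_eq_zero_iff_dvd b 2).mp hv⟩
  rw [Int.cast_ofNat] at h2
  exact h2

/-- An admissible `x` (prime to `3·4k`) has odd norm. [cite: IrelandRosen1990, Ch. 18 §7 («if `P ∣ 6D` then `χ(P) = 0`»)] -/
theorem odd_absNorm_of_adm {a b : ℤ} (hadm : Adm ((4 * k : ℤ) : 𝓞 K3) (Ideal.span {mkInt a b})) :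
    Odd (Ideal.absNorm (Ideal.span {mkInt a b})) := by
  by_contra hodd
  rw [Nat.not_odd_iff_even, even_iff_two_dvd] at hodd
  have h2 : (2 : ℤ) ∣ a ^ 2 - a * b + b ^ 2 := by
    rw [← absNorm_span_mkInt_cast]; exact_mod_cast hodd
  have hx : (2 : 𝓞 K3) ∣ mkInt a b := two_dvd_of_even_normForm h2
  have hD : (2 : 𝓞 K3) ∣ 3 * ((4 * k : ℤ) : 𝓞 K3) := ⟨((6 * k : ℤ) : 𝓞 K3), by push_cast; ring⟩
  have hcop := hadm.2
  rw [Ideal.isCoprime_span_singleton_iff] at hcop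
  exact K3.prime_two.not_unit (hcop.isUnit_of_dvd' hx hD)

/-- **Periodicity of the weight modulo `M = 36|k|m`.**  With `W(x) = 𝟙[x ≡ 1 (3)] · c(N x) · (k/N x) · ν_{4k}((x))`:
`W(x + My) = W(x)` for all `x, y ∈ 𝓞 K3` (`ν_{4k}` has modulus `9·4k` and support `(x, 12k) = 1`, both congruence conditions modulo `M`;
`N(x + My) ≡ N(x)` modulo `m` and modulo `4|k|`, and `(k/·)` only depends on the odd norm modulo `4|k|`).
[cite: IrelandRosen1990, Ch. 18 §6, proof of Theorem 7 («`χ(A)` depends only on `A` modulo the conductor»)] [cite: Hecke1920, §9] -/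
theorem weight_periodic [NeZero m] (x y : 𝓞 K3) :
    (fun x : 𝓞 K3 ↦ if x - 1 ∈ three then c ((Ideal.absNorm (Ideal.span {x}) : ℕ) : ZMod m) *
        (jacobiSym k (Ideal.absNorm (Ideal.span {x})) : ℂ) * grossenNu ((4 * k : ℤ) : 𝓞 K3) 1 0 (Ideal.span {x}) else 0)
      (x + ((36 * k.natAbs * m : ℕ) : 𝓞 K3) * y) =
    (fun x : 𝓞 K3 ↦ if x - 1 ∈ three then c ((Ideal.absNorm (Ideal.span {x}) : ℕ) : ZMod m) *
        (jacobiSym k (Ideal.absNorm (Ideal.span {x})) : ℂ) * grossenNu ((4 * k : ℤ) : 𝓞 K3) 1 0 (Ideal.span {x}) else 0) x := by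
  set D : 𝓞 K3 := ((4 * k : ℤ) : 𝓞 K3) with hD
  set M : ℕ := 36 * k.natAbs * m with hM
  set x' : 𝓞 K3 := x + ((M : ℕ) : 𝓞 K3) * y with hx'
  have hMk : (36 * k : ℤ) ∣ (M : ℤ) := by
    rw [hM]; push_cast
    exact (mul_dvd_mul_left 36 (self_dvd_abs k)).mul_right _
  -- `x' − x ∈ (9D) ⊆ (3D) ⊆ (3)`
  have h9D : x' - x ∈ Ideal.span {9 * D} := by
    obtain ⟨t, ht⟩ := hMk
    refine Ideal.mem_span_singleton'.mpr ⟨((t : ℤ) : 𝓞 K3) * y, ?_⟩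
    rw [hx', hD, add_sub_cancel_left, show ((M : ℕ) : 𝓞 K3) = ((M : ℤ) : 𝓞 K3) by push_cast; rfl, ht]
    push_cast; ring
  have h3 : x' - 1 ∈ three ↔ x - 1 ∈ three := by
    have hmem : x' - x ∈ three := Ideal.span_singleton_le_span_singleton.mpr ⟨3 * D, by ring⟩ h9D
    constructor
    · intro h; have := three.sub_mem h hmem; rwa [show x' - 1 - (x' - x) = x - 1 by ring] at this
    · intro h; have := three.add_mem h hmem; rwa [show x - 1 + (x' - x) = x' - 1 by ring] at this
  simp only
  by_cases h1 : x - 1 ∈ three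
  swap
  · rw [if_neg h1, if_neg (fun h ↦ h1 (h3.mp h))]
  rw [if_pos h1, if_pos (h3.mpr h1)]
  by_cases hadm : Adm D (Ideal.span {x})
  swap
  · -- both `ν`-values vanish
    have hadm' : ¬ Adm D (Ideal.span {x'}) := by
      intro h'
      apply hadm
      have hsub : x - x' ∈ Ideal.span {9 * D} := by rw [← neg_sub]; exact (Ideal.span {9 * D}).neg_mem h9D
      exact ⟨by rw [Ne, Ideal.span_singleton_eq_bot]; exact ne_zero_of_sub_mem h'.2 hsub, isCoprime_of_sub_mem h'.2 hsub⟩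
    rw [grossenNu_apply, if_neg hadm', grossenNu_apply, if_neg hadm, mul_zero, mul_zero]
  -- admissible case
  have hx0 : x ≠ 0 := fun h ↦ hadm.1 (by rw [h, Ideal.span_singleton_eq_bot])
  have hx'0 : x' ≠ 0 := ne_zero_of_sub_mem hadm.2 h9D
  have hadm' : Adm D (Ideal.span {x'}) :=
    ⟨by rw [Ne, Ideal.span_singleton_eq_bot]; exact hx'0, isCoprime_of_sub_mem hadm.2 h9D⟩
  have hν : grossenNu D 1 0 (Ideal.span {x'}) = grossenNu D 1 0 (Ideal.span {x}) := by
    rw [grossenNu_apply, if_pos hadm', grossenNu_apply, if_pos hadm, psi_span_eq_of_sub_mem D hx'0 hx0 hadm.2 h9D,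
      sectorWeight, sectorWeight, pow_zero, pow_zero]
  -- norms
  obtain ⟨a, b, rfl⟩ := exists_eq_mkInt x
  obtain ⟨a', b', rfl⟩ := exists_eq_mkInt y
  have hxy : x' = mkInt (a + M * a') (b + M * b') := by
    rw [hx', show ((M : ℕ) : 𝓞 K3) = mkInt M 0 by rw [mkInt_intCast]; push_cast; rfl, mkInt_mul, mkInt_add]
    congr 1 <;> ring
  have hN : ((Ideal.absNorm (Ideal.span {x'}) : ℕ) : ℤ) = (Ideal.absNorm (Ideal.span {mkInt a b}) : ℕ) +
      M * (2 * a * a' + M * a' ^ 2 - a * b' - a' * b - M * a' * b' + 2 * b * b' + M * b' ^ 2) := by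
    rw [hxy, absNorm_span_mkInt_cast, absNorm_span_mkInt_cast, normForm_add_mul]
  have hNm : ((Ideal.absNorm (Ideal.span {x'}) : ℕ) : ZMod m) = ((Ideal.absNorm (Ideal.span {mkInt a b}) : ℕ) : ZMod m) := by
    have h := congrArg (Int.cast : ℤ → ZMod m) hN
    push_cast at h
    rw [h, show ((M : ℕ) : ZMod m) = 0 by rw [ZMod.natCast_eq_zero_iff, hM]; exact dvd_mul_left _ _, zero_mul, add_zero]
  have hodd : Odd (Ideal.absNorm (Ideal.span {mkInt a b})) := odd_absNorm_of_adm k hadm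
  have hcong : ∀ d : ℕ, (d : ℤ) ∣ (M : ℤ) →
      Ideal.absNorm (Ideal.span {x'}) % d = Ideal.absNorm (Ideal.span {mkInt a b}) % d := by
    intro d hd
    obtain ⟨e, he⟩ := hd
    have h : ((Ideal.absNorm (Ideal.span {x'}) : ℕ) : ℤ) % (d : ℕ) =
        ((Ideal.absNorm (Ideal.span {mkInt a b}) : ℕ) : ℤ) % (d : ℕ) := by
      rw [hN, he, mul_assoc, Int.add_mul_emod_self_left]
    rwa [← Int.natCast_mod, ← Int.natCast_mod, Nat.cast_inj] at h
  have hodd' : Odd (Ideal.absNorm (Ideal.span {x'})) := by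
    rw [Nat.odd_iff] at hodd ⊢
    rw [← hodd]
    exact hcong 2 ⟨18 * k.natAbs * m, by rw [hM]; push_cast; ring⟩
  have hmod : Ideal.absNorm (Ideal.span {x'}) % (4 * k.natAbs) = Ideal.absNorm (Ideal.span {mkInt a b}) % (4 * k.natAbs) :=
    hcong (4 * k.natAbs) ⟨9 * m, by rw [hM]; push_cast; ring⟩
  have hJ : jacobiSym k (Ideal.absNorm (Ideal.span {x'})) = jacobiSym k (Ideal.absNorm (Ideal.span {mkInt a b})) := by
    rw [jacobiSym.mod_right k hodd', jacobiSym.mod_right k hodd, hmod]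
  rw [hNm, hJ, hν]

/-- **The weight takes algebraic-integer values** when `c` does (`(k/N x) ∈ {0, ±1}`, `ν_{4k} ∈ {0} ∪ μ₃`).
[cite: IrelandRosen1990, Ch. 18 §6 (the values of `χ` are algebraic integers)] -/
theorem isIntegral_weight (hc : ∀ a, IsIntegral ℤ (c a)) (x : 𝓞 K3) :
    IsIntegral ℤ ((fun x : 𝓞 K3 ↦ if x - 1 ∈ three then c ((Ideal.absNorm (Ideal.span {x}) : ℕ) : ZMod m) *
        (jacobiSym k (Ideal.absNorm (Ideal.span {x})) : ℂ) * grossenNu ((4 * k : ℤ) : 𝓞 K3) 1 0 (Ideal.span {x}) else 0) x) := by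
  simp only
  split_ifs with h1
  · refine ((hc _).mul ?_).mul ?_
    · rw [show ((jacobiSym k (Ideal.absNorm (Ideal.span {x})) : ℤ) : ℂ) =
        algebraMap ℤ ℂ (jacobiSym k (Ideal.absNorm (Ideal.span {x}))) from (eq_intCast _ _).symm]
      exact isIntegral_algebraMap
    · rw [grossenNu_apply]
      split_ifs with hadm
      · rw [pow_one, sectorWeight, pow_zero, mul_one]
        refine IsIntegral.of_pow (by norm_num : 0 < 3) ?_
        rw [← Units.val_pow_eq_pow_val, psi_pow_three, Units.val_one]
        exact isIntegral_one
      · exact isIntegral_zero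
  · exact isIntegral_zero

end Weight

/-! ### §4 The twisted `L`-series as a theta `L`-series -/

/-- `Σ_{a² − ab + b² = n} W(a + bζ) e(a + bζ) = c(n) a_n(E^k)` for the weight `W = W_{k,c}` (`k ≠ 0` sixth-power-free, not `16u` with
`u ≡ 1 (4)`). [cite: IrelandRosen1990, Ch. 18 §7 with §6 Theorem 7 (PDF pp. 304–306)] -/
theorem sum_normEq_weight_eq (hk : k ≠ 0) (h6 : ∀ q : ℕ, q.Prime → ¬ (q : ℤ) ^ 6 ∣ k)
    (h2 : ¬ ∃ u : ℤ, u % 4 = 1 ∧ k = 16 * u) (c : ZMod m → ℂ) (n : ℕ) :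
    ∑ p ∈ ((Finset.Icc (-((n + 1 : ℕ) : ℤ)) (n + 1 : ℕ)) ×ˢ (Finset.Icc (-((n + 1 : ℕ) : ℤ)) (n + 1 : ℕ))).filter
        (fun p : ℤ × ℤ ↦ p.1 ^ 2 - p.1 * p.2 + p.2 ^ 2 = n),
      (fun x : 𝓞 K3 ↦ if x - 1 ∈ three then c ((Ideal.absNorm (Ideal.span {x}) : ℕ) : ZMod m) *
          (jacobiSym k (Ideal.absNorm (Ideal.span {x})) : ℂ) * grossenNu ((4 * k : ℤ) : 𝓞 K3) 1 0 (Ideal.span {x}) else 0)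
        (mkInt p.1 p.2) * embC ((mkInt p.1 p.2 : 𝓞 K3) : K3) =
      c (n : ZMod m) * ((mordellCurve (k : ℚ)).LFunction n : ℂ) := by
  rw [← sum_primary_normEq_eq_lFunction hk h6 h2 n, Finset.mul_sum]
  conv_rhs => rw [Finset.sum_filter]
  refine Finset.sum_congr rfl fun p hp ↦ ?_
  rw [mem_filter_normForm] at hp
  have hN : Ideal.absNorm (Ideal.span {mkInt p.1 p.2}) = n := by
    zify; rw [absNorm_span_mkInt_cast, hp]
  simp only [hN]
  split_ifs with h1
  · ring
  · rw [zero_mul]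

/-- **Theorem 18.7 with Hecke's continuation, for `y² = x³ + k`: `Σ_n c(n) a_n(E^k) n⁻ˢ = (4^s/2) · Θ-L_{2M}(Φ♯)(s)`** for `re s > 3/2`,
where `M = 36|k|m`, `Φ(d₁, d₂) = W_{k,c}(d₁ − d₂ζ)` on `ℤ² ≅ 𝒪₃` (QuadOrder coordinates `γ = d₁ + d₂ω₃`), `Φ♯ = QuadOrder.parityLift Φ`
and `Θ-L = BinaryTheta.thetaLFunction 3 (2M) · 1 (−√3 i)` is the entire weight-one theta `L`-function of `y₁² + 3y₂²`
(`k ≠ 0` sixth-power-free, not `16u` with `u ≡ 1 (4)`; any `c : ℤ/m → ℂ`).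
[cite: IrelandRosen1990, Ch. 18 §7 (`L(E, s) = L(s, χ)`) and §5 Theorem 6] [cite: KoblitzECMF1993, Ch. II §5, Theorem (proof)] -/
theorem lSeries_twist_eq_thetaLFunction (hk : k ≠ 0) (h6 : ∀ q : ℕ, q.Prime → ¬ (q : ℤ) ^ 6 ∣ k)
    (h2 : ¬ ∃ u : ℤ, u % 4 = 1 ∧ k = 16 * u) [NeZero m] (c : ZMod m → ℂ) :
    ∃ (M : ℕ) (_ : NeZero M) (_ : NeZero (2 * M)) (Φ : ℤ × ℤ → ℂ),
      M = 36 * k.natAbs * m ∧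
      (∀ d : ℤ × ℤ, Φ d = (fun x : 𝓞 K3 ↦ if x - 1 ∈ three then c ((Ideal.absNorm (Ideal.span {x}) : ℕ) : ZMod m) *
          (jacobiSym k (Ideal.absNorm (Ideal.span {x})) : ℂ) * grossenNu ((4 * k : ℤ) : 𝓞 K3) 1 0 (Ideal.span {x}) else 0)
          (mkInt d.1 (-d.2))) ∧
      (∀ d z : ℤ × ℤ, Φ (d.1 + M * z.1, d.2 + M * z.2) = Φ d) ∧
      ((∀ a, IsIntegral ℤ (c a)) → ∀ d, IsIntegral ℤ (Φ d)) ∧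
      ∀ s : ℂ, 3 / 2 < s.re →
        LSeries (fun n : ℕ ↦ c (n : ZMod m) * ((mordellCurve (k : ℚ)).LFunction n : ℂ)) s =
          (4 : ℂ) ^ s / 2 * BinaryTheta.thetaLFunction 3 (2 * M) 1 (-((Real.sqrt 3 : ℂ) * I)) (QuadOrder.parityLift Φ) s := by
  set M : ℕ := 36 * k.natAbs * m with hM
  haveI hM0 : NeZero M :=
    ⟨by rw [hM]; exact Nat.mul_ne_zero (Nat.mul_ne_zero (by norm_num) (Int.natAbs_ne_zero.mpr hk)) (NeZero.ne m)⟩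
  haveI h2M0 : NeZero (2 * M) := ⟨Nat.mul_ne_zero two_ne_zero (NeZero.ne M)⟩
  set W : 𝓞 K3 → ℂ := fun x : 𝓞 K3 ↦ if x - 1 ∈ three then c ((Ideal.absNorm (Ideal.span {x}) : ℕ) : ZMod m) *
      (jacobiSym k (Ideal.absNorm (Ideal.span {x})) : ℂ) * grossenNu ((4 * k : ℤ) : 𝓞 K3) 1 0 (Ideal.span {x}) else 0 with hW
  set Φ : ℤ × ℤ → ℂ := fun d : ℤ × ℤ ↦ W (mkInt d.1 (-d.2)) with hΦdef
  have hΦ : ∀ d z : ℤ × ℤ, Φ (d.1 + M * z.1, d.2 + M * z.2) = Φ d := by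
    intro d z
    have h := weight_periodic k m c (mkInt d.1 (-d.2)) (mkInt z.1 (-z.2))
    change W (mkInt d.1 (-d.2) + ((M : ℕ) : 𝓞 K3) * mkInt z.1 (-z.2)) = W (mkInt d.1 (-d.2)) at h
    have e : mkInt d.1 (-d.2) + ((M : ℕ) : 𝓞 K3) * mkInt z.1 (-z.2) = mkInt (d.1 + M * z.1) (-(d.2 + M * z.2)) := by
      rw [show ((M : ℕ) : 𝓞 K3) = mkInt M 0 by rw [mkInt_intCast]; push_cast; rfl, mkInt_mul, mkInt_add]
      congr 1 <;> ring
    rw [e] at h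
    exact h
  refine ⟨M, hM0, h2M0, Φ, rfl, fun d ↦ rfl, hΦ, fun hc d ↦ isIntegral_weight k m c hc _, fun s hs ↦ ?_⟩
  rw [BinaryTheta.thetaLFunction_eq_LSeries 3 (2 * M) 1 _ _ (QuadOrder.parityLift_periodic M _ hΦ) hs, hΦdef,
    lSeries_coeff_parityLift W s, LSeries_congr (fun {n} _ ↦ sum_normEq_weight_eq hk h6 h2 c n) s]
  have h4 : (4 : ℂ) ^ s ≠ 0 := by
    rw [Ne, cpow_eq_zero_iff, not_and_or]; exact Or.inl (by norm_num)
  rw [cpow_neg]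
  field_simp

/-- **An entire continuation of `Σ_n c(n) a_n(E^k) n⁻ˢ`** (Ireland–Rosen Theorem 18.6 for these characters; Hecke 1920 §9).
[cite: IrelandRosen1990, Ch. 18 §5 Theorem 6] [cite: KoblitzECMF1993, Ch. II §5, Theorem (proof)] -/
theorem exists_differentiable_twist (hk : k ≠ 0) (h6 : ∀ q : ℕ, q.Prime → ¬ (q : ℤ) ^ 6 ∣ k)
    (h2 : ¬ ∃ u : ℤ, u % 4 = 1 ∧ k = 16 * u) [NeZero m] (c : ZMod m → ℂ) :
    ∃ L : ℂ → ℂ, Differentiable ℂ L ∧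
      ∀ s : ℂ, 3 / 2 < s.re → L s = LSeries (fun n : ℕ ↦ c (n : ZMod m) * ((mordellCurve (k : ℚ)).LFunction n : ℂ)) s := by
  obtain ⟨M, hM0, h2M0, Φ, -, -, -, -, hL⟩ := lSeries_twist_eq_thetaLFunction hk h6 h2 c
  refine ⟨fun s ↦ (4 : ℂ) ^ s / 2 * BinaryTheta.thetaLFunction 3 (2 * M) 1 (-((Real.sqrt 3 : ℂ) * I)) (QuadOrder.parityLift Φ) s,
    ?_, fun s hs ↦ (hL s hs).symm⟩
  refine Differentiable.mul (Differentiable.div_const (fun s ↦ ?_) 2) (BinaryTheta.differentiable_thetaLFunction 3 (2 * M) 1 _ _)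
  exact differentiableAt_id.const_cpow (Or.inl (by norm_num))

end SexticTwist

end Literature.NumberTheory.EllipticCurves

end
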